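import Summits.Ventures.YMGap.RobustBall.PerturbedReflectionCovariance
import Summits.Ventures.YMGap.RobustBall.PerturbedAxisCovariancePairs
import HarnessLib

/-!
# Venture YMGap, track ROBUST-BALL — ONE STATE, step 16: the TIER-2 (link-summable) perturbed specification under the axis
# reflections; the one state of a reflection-symmetric summable member is reflection symmetric

HONEST FRAMING. WHAT THIS IS: a venture file (cell `pub-ymgap`, track Y2 ROBUST-BALL, seat ds-3, theorems only), the tier-2 twin
of `OneStateReflection.lean` (as `PerturbedAxisCovariancePairs.lean` is the tier-2 twin of `PerturbedAxisCovariance.lean`): for a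
link-summable potential `W` with continuous terms that is COVARIANT under the axis reflection `x_i ↦ −x_i`
(`W_{𝓻X}(configSiteReflect i U) = W_X(U)`, `𝓻` the reflected-link map of the gauge-boot convention), the tier-2 energy is
reflection covariant (`perturbedEnergyS_reflect`: the series over the finite link sets meeting the volume is re-indexed along
`X ↦ 𝓻X`), so is the tier-2 specification `perturbedYMS` (`perturbedYMS_map_configSiteReflect`, by the generic twisted relabelling
`Covariance.tilted_glueWith_map_twist` with inversion on the links along direction `i`), its DLR set is reflection stable
(`map_configSiteReflect_mem_perturbedGibbsMeasuresS`), and ★★ under `PerturbedMassGapAtS` THE ONE STATE IS REFLECTION INVARIANT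
(`oneState_reflectInvariant_of_perturbedMassGapAtS`). WHAT THIS IS NOT: no concrete tier-2 member is certified reflection
covariant here — the tree's isotropic pair couplings `τ κ^{‖x_p − x_q‖₁}` are indexed by plaquette BASE POINTS, which a
reflection does not map to base points (translations and axis permutations do), so they are not literally reflection symmetric;
a centre-indexed variant would be. Lattice statements only; nothing about the continuum limit or the Clay Millennium problem.

References: H.-O. Georgii (2011), §5.1; the track's `PerturbedReflectionCovariance.lean`, `PerturbedAxisCovariancePairs.lean`,
`SummableSpecification.lean`.
-/

noncomputable section

open MeasureTheory Filter Function
open Literature.Probability.LatticeModels hiding configShift configShift_apply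
open Literature.MathematicalPhysics.QuantumLattice
open Literature.MathematicalPhysics.QuantumFieldTheory hiding ZdEdge Site
open Summit.QuantumFields.GaugeBoot (zdSiteReflect configSiteReflect configSiteReflect_apply zdSiteReflect_zdSiteReflect
  zdSiteReflect_sub_single configSiteReflect_configSiteReflect measurable_configSiteReflect)

namespace Summit.Ventures.YMGap.RobustBall

/-! ### The tier-2 carrier under reflections -/

section CarrierS

variable {d N : ℕ} {G : Type*} [Group G] (ρ : G →* Matrix (Fin N) (Fin N) ℂ)
  [TopologicalSpace G] [IsTopologicalGroup G] [CompactSpace G]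

/-- **Reflection covariance of the tier-2 perturbed energy** for a reflection-covariant potential (the series over all finite
link sets meeting the volume is re-indexed along the involution `X ↦ 𝓻X`). [folklore] -/
theorem perturbedEnergyS_reflect (hρ : Continuous ρ) (β : ℝ) {W : Potential (ZdEdge d) G} (i : Fin d)
    (hW : ∀ (X : Finset (ZdEdge d)) (U : LGConfig d G),
      W (X.image (fun x : ZdEdge d =>
          if x.2 = i then (zdSiteReflect i x.1 - Pi.single i 1, i) else (zdSiteReflect i x.1, x.2))) (configSiteReflect i U) =
        W X U)
    (Λ : Finset (ZdEdge d)) (U : LGConfig d G) :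
    perturbedEnergyS ρ β W
        (Λ.image (fun x : ZdEdge d =>
          if x.2 = i then (zdSiteReflect i x.1 - Pi.single i 1, i) else (zdSiteReflect i x.1, x.2)))
        (configSiteReflect i U) = perturbedEnergyS ρ β W Λ U := by
  classical
  have hinv := reflectEdge_involutive (d := d) i
  set e : ZdEdge d ≃ ZdEdge d := hinv.toPerm _ with he
  have hmap : ∀ X : Finset (ZdEdge d), X.map e.toEmbedding =
      X.image (fun x : ZdEdge d =>
        if x.2 = i then (zdSiteReflect i x.1 - Pi.single i 1, i) else (zdSiteReflect i x.1, x.2)) := fun X => by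
    rw [Finset.map_eq_image]
    rfl
  simp only [perturbedEnergyS, wilsonBoundaryAction_reflect ρ hρ]
  congr 1
  rw [← (Equiv.finsetCongr e).tsum_eq]
  refine tsum_congr fun X => ?_
  simp only [Equiv.finsetCongr_apply, hmap, ← Finset.image_inter _ _ hinv.injective, Finset.image_nonempty, hW]

variable [MeasurableSpace G] [BorelSpace G] [SecondCountableTopology G]

/-- ★ **Reflection covariance of the tier-2 perturbed specification** (link-summable reflection-covariant potential with
continuous terms): `γ^{W,S}_Λ(· | η) ∘ (configSiteReflect i)⁻¹ = γ^{W,S}_{𝓻Λ}(· | configSiteReflect i η)`. [folklore] -/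
theorem perturbedYMS_map_configSiteReflect (hρ : Continuous ρ) (β : ℝ) {W : Potential (ZdEdge d) G}
    {B : Finset (ZdEdge d) → ℝ} (hB : IsLinkSummable W B) (hWc : ∀ X, Continuous (W X)) (i : Fin d)
    (hW : ∀ (X : Finset (ZdEdge d)) (U : LGConfig d G),
      W (X.image (fun x : ZdEdge d =>
          if x.2 = i then (zdSiteReflect i x.1 - Pi.single i 1, i) else (zdSiteReflect i x.1, x.2))) (configSiteReflect i U) =
        W X U)
    (Λ : Finset (ZdEdge d)) (η : LGConfig d G) :
    (perturbedYMS ρ β W Λ η).map (configSiteReflect i) =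
      perturbedYMS ρ β W
        (Λ.image (fun x : ZdEdge d =>
          if x.2 = i then (zdSiteReflect i x.1 - Pi.single i 1, i) else (zdSiteReflect i x.1, x.2)))
        (configSiteReflect i η) := by
  classical
  have hinv := reflectEdge_involutive (d := d) i
  set e : ZdEdge d ≃ ZdEdge d := hinv.toPerm _ with he
  have hmap : Λ.map e.toEmbedding =
      Λ.image (fun x : ZdEdge d =>
        if x.2 = i then (zdSiteReflect i x.1 - Pi.single i 1, i) else (zdSiteReflect i x.1, x.2)) := by
    rw [Finset.map_eq_image]
    rfl
  let T : LGConfig d G ≃ᵐ LGConfig d G :=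
    { toFun := configSiteReflect i, invFun := configSiteReflect i,
      left_inv := configSiteReflect_configSiteReflect i, right_inv := configSiteReflect_configSiteReflect i,
      measurable_toFun := measurable_configSiteReflect i, measurable_invFun := measurable_configSiteReflect i }
  have hT : ∀ (U : LGConfig d G) (x : ZdEdge d), T U x =
      (fun x : ZdEdge d => if x.2 = i then MeasurableEquiv.inv G else MeasurableEquiv.refl G) x (U (e.symm x)) := by
    intro U x
    show configSiteReflect i U x = _
    rw [Function.Involutive.toPerm_symm, Function.Involutive.coe_toPerm]
    by_cases hx : x.2 = i
    · simp only [configSiteReflect_apply, hx, ↓reduceIte]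
      rfl
    · simp only [configSiteReflect_apply, hx, ↓reduceIte]
      rfl
  have hφ : ∀ x : ZdEdge d, MeasurePreserving
      ((fun x : ZdEdge d => if x.2 = i then MeasurableEquiv.inv G else MeasurableEquiv.refl G) x)
      (haarProbability G) (haarProbability G) := by
    intro x
    by_cases hx : x.2 = i
    · simp only [hx, ↓reduceIte]
      exact Measure.measurePreserving_inv (haarProbability G)
    · simp only [hx, ↓reduceIte]
      exact MeasurePreserving.id _
  have hcov : ∀ U : LGConfig d G, perturbedEnergyS ρ β W (Λ.map e.toEmbedding) (T U) = perturbedEnergyS ρ β W Λ U :=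
    fun U => by
    rw [hmap]
    exact perturbedEnergyS_reflect ρ hρ β i hW Λ U
  have key := Covariance.tilted_glueWith_map_twist _ _ (continuous_perturbedEnergyS ρ hρ β hB hWc Λ)
    (continuous_perturbedEnergyS ρ hρ β hB hWc _) Λ T e _ hT hφ hcov η
  rw [← hmap]
  exact key

/-- ★ **Tier 2: the image of a DLR state of a reflection-covariant summable member under the reflection is a DLR state.**
[folklore] -/
theorem map_configSiteReflect_mem_perturbedGibbsMeasuresS [T2Space G] (hρ : Continuous ρ) (β : ℝ)
    {W : Potential (ZdEdge d) G} {B : Finset (ZdEdge d) → ℝ} (hB : IsLinkSummable W B)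
    (hWc : ∀ X, Continuous (W X)) (hdep : ∀ X, DependsOn (W X) (↑X : Set (ZdEdge d))) (i : Fin d)
    (hW : ∀ (X : Finset (ZdEdge d)) (U : LGConfig d G),
      W (X.image (fun x : ZdEdge d =>
          if x.2 = i then (zdSiteReflect i x.1 - Pi.single i 1, i) else (zdSiteReflect i x.1, x.2))) (configSiteReflect i U) =
        W X U)
    {μ : Measure (LGConfig d G)} (hμ : μ ∈ perturbedGibbsMeasuresS (d := d) ρ β W) :
    μ.map (configSiteReflect i) ∈ perturbedGibbsMeasuresS (d := d) ρ β W := by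
  classical
  have hinv := reflectEdge_involutive (d := d) i
  set e : ZdEdge d ≃ ZdEdge d := hinv.toPerm _ with he
  have hmap : ∀ Λ : Finset (ZdEdge d), Λ.map e.toEmbedding =
      Λ.image (fun x : ZdEdge d =>
        if x.2 = i then (zdSiteReflect i x.1 - Pi.single i 1, i) else (zdSiteReflect i x.1, x.2)) := fun Λ => by
    rw [Finset.map_eq_image]
    rfl
  let T : LGConfig d G ≃ᵐ LGConfig d G :=
    { toFun := configSiteReflect i, invFun := configSiteReflect i,
      left_inv := configSiteReflect_configSiteReflect i, right_inv := configSiteReflect_configSiteReflect i,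
      measurable_toFun := measurable_configSiteReflect i, measurable_invFun := measurable_configSiteReflect i }
  exact Covariance.map_equiv_mem_gibbsMeasures (isSpecification_perturbedYMS ρ hρ β hB hWc hdep) T e
    (fun Λ η => by rw [hmap]; exact perturbedYMS_map_configSiteReflect ρ hρ β hB hWc i hW Λ η) hμ

end CarrierS

/-- ★★ **TIER 2: THE ONE STATE OF A REFLECTION-COVARIANT LINK-SUMMABLE MEMBER IS REFLECTION INVARIANT** (no Van Hove join).
[folklore] -/
theorem oneState_reflectInvariant_of_perturbedMassGapAtS {d N : ℕ} {β : ℝ} {W : Potential (ZdEdge d) (SUN N)}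
    (hgap : PerturbedMassGapAtS d N β W) {B : Finset (ZdEdge d) → ℝ} (hB : IsLinkSummable W B)
    (hWc : ∀ X, Continuous (W X)) (hdep : ∀ X, DependsOn (W X) (↑X : Set (ZdEdge d))) (i : Fin d)
    (hW : ∀ (X : Finset (ZdEdge d)) (U : LGConfig d (SUN N)),
      W (X.image (fun x : ZdEdge d =>
          if x.2 = i then (zdSiteReflect i x.1 - Pi.single i 1, i) else (zdSiteReflect i x.1, x.2))) (configSiteReflect i U) =
        W X U) :
    ∃ μ : Measure (LGConfig d (SUN N)),
      perturbedGibbsMeasuresS (d := d) (fundamentalRep (Fin N)) ((N : ℝ) * β) W = {μ} ∧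
        μ.map (configSiteReflect i) = μ := by
  haveI : SecondCountableTopology (Matrix (Fin N) (Fin N) ℂ) :=
    inferInstanceAs (SecondCountableTopology (Fin N → Fin N → ℂ))
  haveI : SecondCountableTopology (SUN N) := Topology.IsEmbedding.subtypeVal.secondCountableTopology
  obtain ⟨hsub, ⟨μ, hμ⟩⟩ := hgap.1
  exact ⟨μ, Set.eq_singleton_iff_unique_mem.2 ⟨hμ, fun ν hν => hsub hν hμ⟩,
    hsub (map_configSiteReflect_mem_perturbedGibbsMeasuresS _ (continuous_fundamentalRep (Fin N)) _ hB hWc hdep i hW hμ) hμ⟩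

end Summit.Ventures.YMGap.RobustBall

end
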